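import Summits.Ventures.PercRepro.ProfileGapMonoThresholdAvgOneCharge

/-!
# PercRepro — THE PER-SET BOUNDS OF THE STRONG AVERAGED STEP AT `(q, t) = (2, 1)` ON A LOOPLESS MATROID
(p5, gen 28; `proofs/P5-GM1.md` §31(b))

For a rank-`1` set `B` (class `P = clF N B`, `X = E ∖ B`, `m = ρ(X)`, `κ = #coloops X`, `Y = E ∖ P`) the demand
`(#E − 2) · [2 ≤ m] m` of the strong step is paid by the surviving demand `(#X − κ) [2 ≤ m] m + κ [2 ≤ m − 1] (m − 1)`
of the deletions plus the shares of the up-sets with the weight `g_1(S) = #S − 2 + [ρ(E∖S) = 1] κ(E∖S)`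
(`ProfileGapMonoThresholdAvgOneCharge`).  NO set is short: a singleton needs nothing at `m ≥ 3` (`κ ≤ m`) and
`2 (κ − 1)` at `m = 2`, which its coloop deaths pay (`av_point_bound_singleton_big` / `_small`); a set with `≥ 2`
points pays in full from its `#Y` up-sets (`av_point_bound_two_le`).
-/

open scoped Matroid

namespace PercRepro.Cogirth

open Finset ThmH Skew Shadow Profile

variable {α : Type} [DecidableEq α] {N : Matroid α} [N.Finite]

section Arith

/-- The arithmetic of a singleton: `(x + 1 − 2) · [2 ≤ m] m ≤ (x − k) [2 ≤ m] m + k [2 ≤ m − 1] (m − 1) + [2 ≤ m] s`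
when `k ≤ m ≤ x` and `2 (k − 1) ≤ s` at `m = 2`. -/
theorem av_arith_singleton (x m k s : ℕ) (hmx : m ≤ x) (hkm : k ≤ m) (h2 : m = 2 → 2 * (k - 1) ≤ s) :
    (x + 1 - 2) * (if 2 ≤ m then m else 0) ≤
      (x - k) * (if 2 ≤ m then m else 0) + k * (if 2 ≤ m - 1 then m - 1 else 0) +
        (if 2 ≤ m then s else 0) := by
  by_cases h3 : 3 ≤ m
  · rw [if_pos (by omega), if_pos (by omega), if_pos (by omega)]
    obtain ⟨d, rfl⟩ : ∃ d, x = k + d := ⟨x - k, by omega⟩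
    obtain ⟨e, rfl⟩ : ∃ e, m = e + 1 := ⟨m - 1, by omega⟩
    rw [Nat.add_sub_cancel_left, Nat.add_sub_cancel]
    obtain ⟨w, hw⟩ : ∃ w, k + d = w + 1 := ⟨k + d - 1, by omega⟩
    rw [show k + d + 1 - 2 = w by omega]
    nlinarith [hw, hkm]
  · by_cases hm : m = 2
    · subst hm
      rw [if_pos (by norm_num), if_neg (by norm_num), if_pos (by norm_num)]
      have := h2 rfl
      obtain ⟨d, rfl⟩ : ∃ d, x = k + d := ⟨x - k, by omega⟩
      rw [Nat.add_sub_cancel_left]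
      omega
    · rw [if_neg (by omega), if_neg (by omega), if_neg (by omega)]
      omega

/-- The arithmetic of a set of `a ≥ 2` points: `(x + a − 2) · [2 ≤ m] m ≤ (x − k) [2 ≤ m] m + k [2 ≤ m − 1] (m − 1)
+ [2 ≤ m] s` when `k ≤ x`, `(a − 2) m + k ≤ s` at `m ≥ 3` and `2 (a − 2 + k) ≤ s` at `m = 2`. -/
theorem av_arith_big (x a m k s : ℕ) (ha : 2 ≤ a) (hkx : k ≤ x) (h3 : 3 ≤ m → (a - 2) * m + k ≤ s)
    (h2 : m = 2 → 2 * (a - 2 + k) ≤ s) :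
    (x + a - 2) * (if 2 ≤ m then m else 0) ≤
      (x - k) * (if 2 ≤ m then m else 0) + k * (if 2 ≤ m - 1 then m - 1 else 0) +
        (if 2 ≤ m then s else 0) := by
  by_cases h3' : 3 ≤ m
  · rw [if_pos (by omega), if_pos (by omega), if_pos (by omega)]
    have hs := h3 h3'
    obtain ⟨d, rfl⟩ : ∃ d, x = k + d := ⟨x - k, by omega⟩
    obtain ⟨e, rfl⟩ : ∃ e, m = e + 1 := ⟨m - 1, by omega⟩
    obtain ⟨c, rfl⟩ : ∃ c, a = c + 2 := ⟨a - 2, by omega⟩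
    rw [Nat.add_sub_cancel_left, Nat.add_sub_cancel]
    rw [Nat.add_sub_cancel] at hs
    rw [show k + d + (c + 2) - 2 = k + d + c by omega]
    nlinarith [hs]
  · by_cases hm : m = 2
    · subst hm
      rw [if_pos (by norm_num), if_neg (by norm_num), if_pos (by norm_num)]
      have := h2 rfl
      obtain ⟨d, rfl⟩ : ∃ d, x = k + d := ⟨x - k, by omega⟩
      rw [Nat.add_sub_cancel_left]
      omega
    · rw [if_neg (by omega), if_neg (by omega), if_neg (by omega)]
      omega

end Arith

section PointBounds

/-- **A singleton of a class with `≥ 2` points, strong step at the threshold `1`**: its demand is paid by its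
surviving demand and the full shares of its coloop deaths. -/
theorem av_point_bound_singleton_big (hloop : ∀ x ∈ gr N, rk N {x} = 1) {b : α} (hb : b ∈ gr N)
    (hP : 2 ≤ (clF N {b}).card) :
    ((gr N).card - 2) * (if 2 ≤ rk N (gr N \ {b}) then rk N (gr N \ {b}) else 0) ≤
      ((gr N \ {b}).card - (coloops N (gr N \ {b})).card) *
          (if 2 ≤ rk N (gr N \ {b}) then rk N (gr N \ {b}) else 0) +
        (coloops N (gr N \ {b})).card *
          (if 2 ≤ rk N (gr N \ {b}) - 1 then rk N (gr N \ {b}) - 1 else 0) +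
      (if 2 ≤ rk N (gr N \ {b}) then
        ∑ y ∈ gr N \ clF N {b},
          (if ({b} : Finset α).card = 1 ∧ 2 ≤ rk N (gr N \ {y}) then 1 else 2) *
            ((insert y ({b} : Finset α)).card - 2 +
              (if rk N (gr N \ insert y {b}) = 1 then (coloops N (gr N \ insert y {b})).card else 0))
      else 0) := by
  have hbg : ({b} : Finset α) ⊆ gr N := singleton_subset_iff.2 hb
  have h1 : rk N {b} = 1 := hloop b hb
  have hX : gr N \ {b} ⊆ gr N := sdiff_subset
  have hXc : (gr N \ {b}).card = (gr N).card - 1 := by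
    rw [card_sdiff_of_subset hbg, card_singleton]
  have hn1 : 1 ≤ (gr N).card := card_pos.2 ⟨b, hb⟩
  have hnX : (gr N).card = (gr N \ {b}).card + 1 := by omega
  have hmx : rk N (gr N \ {b}) ≤ (gr N \ {b}).card := rk_le_card _
  have hκm : (coloops N (gr N \ {b})).card ≤ rk N (gr N \ {b}) := card_coloops_le_rk hX
  rw [hnX]
  apply av_arith_singleton _ _ _ _ hmx hκm
  intro h2
  have hbig := supply_ge_singleton_big_g hloop hb hP (t := 1) h2
  have hF := card_coloops_sdiff_le_filter_add_one (N := N) hloop h1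
  simp only [show (1 : ℕ) + 1 = 2 from rfl] at hbig
  set κ := (coloops N (gr N \ {b})).card with hκdef
  set F := ((coloops N (gr N \ {b})).filter (fun y => y ∉ clF N {b})).card with hFdef
  rcases Nat.lt_or_ge κ 2 with hκ | hκ
  · have : 2 * (κ - 1) = 0 := by omega
    rw [this]
    exact Nat.zero_le _
  · have hF1 : 1 ≤ F := by omega
    calc 2 * (κ - 1) ≤ 2 * (κ - 1) * F := Nat.le_mul_of_pos_right _ hF1
      _ ≤ _ := hbig

/-- **A singleton class, strong step at the threshold `1`** (`clF N {b} = {b}`): its `κ` coloop deaths carry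
`κ (κ − 1) ≥ 2 (κ − 1)`. -/
theorem av_point_bound_singleton_small (hloop : ∀ x ∈ gr N, rk N {x} = 1) {b : α} (hb : b ∈ gr N)
    (hP : (clF N {b}).card = 1) :
    ((gr N).card - 2) * (if 2 ≤ rk N (gr N \ {b}) then rk N (gr N \ {b}) else 0) ≤
      ((gr N \ {b}).card - (coloops N (gr N \ {b})).card) *
          (if 2 ≤ rk N (gr N \ {b}) then rk N (gr N \ {b}) else 0) +
        (coloops N (gr N \ {b})).card *
          (if 2 ≤ rk N (gr N \ {b}) - 1 then rk N (gr N \ {b}) - 1 else 0) +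
      (if 2 ≤ rk N (gr N \ {b}) then
        ∑ y ∈ gr N \ clF N {b},
          (if ({b} : Finset α).card = 1 ∧ 2 ≤ rk N (gr N \ {y}) then 1 else 2) *
            ((insert y ({b} : Finset α)).card - 2 +
              (if rk N (gr N \ insert y {b}) = 1 then (coloops N (gr N \ insert y {b})).card else 0))
      else 0) := by
  have hbg : ({b} : Finset α) ⊆ gr N := singleton_subset_iff.2 hb
  have hB : ({b} : Finset α) ∈ Rq N 1 := by
    rw [mem_Rq]
    exact ⟨hbg, eRk_eq_of_rk_eq_cq (hloop b hb)⟩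
  have hX : gr N \ {b} ⊆ gr N := sdiff_subset
  have hPeq : clF N {b} = {b} := by
    apply Subset.antisymm _ (subset_clF hbg)
    intro x hx
    obtain ⟨a, ha⟩ := card_eq_one.1 hP
    have hb' : b ∈ clF N {b} := subset_clF hbg (mem_singleton_self b)
    rw [ha, mem_singleton] at hx hb'
    rw [mem_singleton, hx, hb']
  have hXc : (gr N \ {b}).card = (gr N).card - 1 := by
    rw [card_sdiff_of_subset hbg, card_singleton]
  have hn1 : 1 ≤ (gr N).card := card_pos.2 ⟨b, hb⟩
  have hnX : (gr N).card = (gr N \ {b}).card + 1 := by omega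
  have hmx : rk N (gr N \ {b}) ≤ (gr N \ {b}).card := rk_le_card _
  have hκm : (coloops N (gr N \ {b})).card ≤ rk N (gr N \ {b}) := card_coloops_le_rk hX
  rw [hnX]
  apply av_arith_singleton _ _ _ _ hmx hκm
  intro h2
  have hsupply := (sum_g_insert_ge hB 1).trans (supply_ge_sum_g (N := N) {b} 1)
  simp only [show (1 : ℕ) + 1 = 2 from rfl] at hsupply
  rw [card_singleton, hPeq] at hsupply
  have hFeq : (coloops N (gr N \ {b})).filter (fun y => y ∉ ({b} : Finset α)) = coloops N (gr N \ {b}) := by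
    apply filter_true_of_mem
    intro y hy
    exact (mem_sdiff.1 (coloops_subset _ hy)).2
  rw [hFeq, if_pos h2] at hsupply
  rw [hPeq]
  set κ := (coloops N (gr N \ {b})).card with hκdef
  have hκκ : 2 * (κ - 1) ≤ (κ - 1) * κ := by
    rcases Nat.lt_or_ge κ 2 with hκ | hκ
    · have : κ - 1 = 0 := by omega
      rw [this]; omega
    · calc 2 * (κ - 1) = (κ - 1) * 2 := mul_comm _ _
        _ ≤ (κ - 1) * κ := Nat.mul_le_mul_left _ hκ
  refine le_trans ?_ hsupply
  omega

/-- **A set with at least two points pays in full, strong step at the threshold `1`**: its `#Y` up-sets, each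
of weight `2 (#B − 1)` plus its deaths, cover `(#B − 2) m + κ` (`m ≥ 3`) and `2 (#B − 2 + κ)` (`m = 2`). -/
theorem av_point_bound_two_le (hloop : ∀ x ∈ gr N, rk N {x} = 1) {B : Finset α} (hB : B ∈ Rq N 1)
    (h2 : 2 ≤ B.card) :
    ((gr N).card - 2) * (if 2 ≤ rk N (gr N \ B) then rk N (gr N \ B) else 0) ≤
      ((gr N \ B).card - (coloops N (gr N \ B)).card) *
          (if 2 ≤ rk N (gr N \ B) then rk N (gr N \ B) else 0) +
        (coloops N (gr N \ B)).card *
          (if 2 ≤ rk N (gr N \ B) - 1 then rk N (gr N \ B) - 1 else 0) +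
      (if 2 ≤ rk N (gr N \ B) then
        ∑ y ∈ gr N \ clF N B,
          (if B.card = 1 ∧ 2 ≤ rk N (gr N \ {y}) then 1 else 2) *
            ((insert y B).card - 2 +
              (if rk N (gr N \ insert y B) = 1 then (coloops N (gr N \ insert y B)).card else 0))
      else 0) := by
  have hBg : B ⊆ gr N := (mem_Rq.1 hB).1
  have h1 : rk N B = 1 := rk_eq_of_eRk_eq_cq (mem_Rq.1 hB).2
  have hX : gr N \ B ⊆ gr N := sdiff_subset
  have hXc : (gr N \ B).card = (gr N).card - B.card := card_sdiff_of_subset hBg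
  have hBn : B.card ≤ (gr N).card := card_le_card hBg
  have hnX : (gr N).card = (gr N \ B).card + B.card := by omega
  have hm : rk N (gr N \ B) ≤ (gr N \ clF N B).card + 1 := by
    have := rk_sdiff_le_rk_sdiff_clF_add_one (N := N) h1 B
    have := rk_le_card (M := N) (gr N \ clF N B)
    omega
  have hκm : (coloops N (gr N \ B)).card ≤ rk N (gr N \ B) := card_coloops_le_rk hX
  have hκX : (coloops N (gr N \ B)).card ≤ (gr N \ B).card := card_le_card (coloops_subset _)
  have hF := card_coloops_sdiff_le_filter_add_one (N := N) hloop h1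
  have hsupply := Nat.mul_le_mul_left 2 (sum_g_insert_ge hB 1)
  rw [supply_eq_two_mul_of_two_le_g h2 1] at hsupply
  simp only [show (1 : ℕ) + 1 = 2 from rfl] at hsupply
  set Y := (gr N \ clF N B).card with hYdef
  set κ := (coloops N (gr N \ B)).card with hκdef
  set F := ((coloops N (gr N \ B)).filter (fun y => y ∉ clF N B)).card with hFdef
  set S := ∑ y ∈ gr N \ clF N B,
        (if B.card = 1 ∧ 2 ≤ rk N (gr N \ {y}) then 1 else 2) *
          ((insert y B).card - 2 +
            (if rk N (gr N \ insert y B) = 1 then (coloops N (gr N \ insert y B)).card else 0)) with hSdef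
  rw [hnX]
  apply av_arith_big _ _ _ _ _ h2 hκX
  · -- `m ≥ 3`: `(#B − 2) m + κ ≤ (#B − 1)(Y + 1) ≤ 2 Y (#B − 1) ≤ S`
    intro h3
    rw [if_neg (by omega)] at hsupply
    have hY1 : 1 ≤ Y := by omega
    obtain ⟨c, hc⟩ : ∃ c, B.card = c + 2 := ⟨B.card - 2, by omega⟩
    rw [hc] at hsupply ⊢
    rw [Nat.add_sub_cancel]
    have hc1 : c + 2 - 1 = c + 1 := by omega
    rw [hc1] at hsupply
    nlinarith [hsupply, hm, hκm, hY1]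
  · -- `m = 2`: `#B − 2 + κ ≤ Y (#B − 1) + (κ − 1) F`
    intro hm2
    rw [if_pos hm2] at hsupply
    have hY1 : 1 ≤ Y := by omega
    have hκ2 : κ ≤ 2 := by omega
    obtain ⟨c, hc⟩ : ∃ c, B.card = c + 2 := ⟨B.card - 2, by omega⟩
    rw [hc] at hsupply ⊢
    rw [Nat.add_sub_cancel]
    have hc1 : c + 2 - 1 = c + 1 := by omega
    rw [hc1] at hsupply
    interval_cases κ
    · nlinarith [hsupply, hY1]
    · nlinarith [hsupply, hY1]
    · have hF1 : 1 ≤ F := by omega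
      nlinarith [hsupply, hY1, hF1]

end PointBounds

end PercRepro.Cogirth
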